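import Mathlib
import HarnessLib.Audit
import Summits.PneNP.PneNP.Theorems.PstarChordReadOutside

/-!
# Outside-gated chords in uniform type `(1,0)`: the second reader is BLIND to the gated privates and to their partners (memo g21 §15, steps 2–4)

FRONTIER range-avoidance ladder, rung F-N3, ROUND 24 (cell `pnp-ideate`, prover-2 memo `g21/O1-CHORD-READ-g21.md` §15 (the affine two-chord theorem);
typed target `PstarCoreBoundTargets.TerminalPeelable` (p646951); restricted-model proof complexity — nothing here bears on `P` versus `NP`).

Setting: a terminal core, two distinct chords `cᵢ, cⱼ` with outside gates `gᵢ = (vᵢ, zᵢ)`, `gⱼ = (vⱼ, zⱼ)` of TYPE `(1,0)` (`g ∈ G₁ ∖ G₂`; every type is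
reduced to this one by the reader symmetries in `PstarChordReadOutsideKill`).  With (T3) alone (rank one for commuting flips, `PstarChordReadFlip`)
and the SINGLE-chord slice genericity of `PstarChordReadLemma` for LINEAR readers, the second reader `Γ₂` turns out to be syntactically blind to
everything the gates touch:

* `mv₂_eq_false_of_typeI` — at every solution with `cᵢ`'s co-private `0`, an outside variable `z` uncoupled from `zᵢ` and in no monomial with `vᵢ`
  does not move `Γ₂` (two-point lemma: `mv z` is parallel to `mv zᵢ` and to `mv zᵢ ⊕ (1,0)`);
* `not_mem_lin₂_of_typeI` — the gated private `vᵢ` is NOT read linearly by `Γ₂` (else the flips of `zⱼ` and `vᵢ` are independent at a point where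
  `zⱼ` moves `Γ₁`: `PstarChordReadFlip.false_of_independent_flips`);
* `invisible₂_of_typeI` — every partner `z'` of the other chord is INVISIBLE to `Γ₂` (`z' ∉ C₂`, `z'` in no monomial of `G₂`): `mv₂ z'` is the linear
  G-constraint `[z' ∈ C₂] ⊕ gval (partners G₂ z') ∅` (`PstarChordReadOutside.mv_eq_partners`), it vanishes on the slice `(0,0)` of `cⱼ`, so it is
  chord-local at `cⱼ` by the slice lemma with the EMPTY menu, and a linear form in AND-type / outside variables that is chord-local is zero
  (indicator test; `Typed` keeps AND variables out of the XOR slots);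
* `chordLocal₂_of_clean` — FREE LUNCH WITH TRANSPORT: if `Γ₂` is blind to `vᵢ` and to `zᵢ` and `gᵢ ∈ G₁`, then `Γ₂` fails on the whole slice
  `co-private = 0` of `cᵢ` (at one of `x, x ⊕ e_{vᵢ}` the switch `zᵢ` moves `Γ₁` only), hence `Γ₂` is chord-local at `cᵢ` (slice lemma, menu `G₂`).

No realisability hypotheses; no Assumption A.
-/

set_option linter.dupNamespace false -- `Summit.PneNP.PneNP.…`: summit = sub-problem name (D-0017 single-conjunct layout)

open Finset Literature.Computability.Complexity
open Summit.PneNP.PneNP.Theorems.PstarFibrePolys (bit bit_injective)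
open Summit.PneNP.PneNP.Theorems.PstarTyped (Typed)
open Summit.PneNP.PneNP.Theorems.PstarSALevel (varSet bdry BoundaryExpanding SimpleOverlap)
open Summit.PneNP.PneNP.Theorems.PstarGapPeeling (not_mem_varSet_of_private)
open Summit.PneNP.PneNP.Theorems.PstarCentreFree (vars_mem_varSet)
open Summit.PneNP.PneNP.Theorems.PstarGapOneAll (gval)
open Summit.PneNP.PneNP.Theorems.PstarGConstraint (gval_false gval_update_of_forall_ne bit_gval)
open Summit.PneNP.PneNP.Theorems.PstarChordRepair (IsChord)
open Summit.PneNP.PneNP.Theorems.PstarCoreBoundTargets (Terminal)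
open Summit.PneNP.PneNP.Theorems.PstarChordBridgeTools (coef)
open Summit.PneNP.PneNP.Theorems.PstarChordReadSwitch (solves_update_of_outside gval₂_ne_of_switch₁)
open Summit.PneNP.PneNP.Theorems.PstarChordReadLemma (ChordLocal SliceGeneric chordLocal_of_fail_slice)
open Summit.PneNP.PneNP.Theorems.PstarChordReadGates (sliceGeneric_mono)
open Summit.PneNP.PneNP.Theorems.PstarChordReadFlip
open Summit.PneNP.PneNP.Theorems.PstarChordReadOutside

namespace Summit.PneNP.PneNP.Theorems.PstarChordReadOutsideClean

variable {n m : ℕ}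

/-! ## Small facts about `partners` -/
section Partners

variable (I : LocalMap 4 n m)

/-- A variable in no monomial of `G` has no partners. -/
theorem partners_eq_empty {G : Finset (Fin m)} {v : Fin n} (hG : ∀ g ∈ G, I.vars g 2 ≠ v ∧ I.vars g 3 ≠ v) : partners I G v = ∅ := by
  unfold partners
  rw [Finset.filter_false_of_mem (fun g hg h => h.elim (hG g hg).1 (hG g hg).2), image_empty]

/-- Conversely, no partners means no monomial of `G` contains `v`. -/
theorem forall_ne_of_partners_eq_empty (hI : I.IsPure xorAndPred) {G : Finset (Fin m)} {v : Fin n} (h : partners I G v = ∅) :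
    ∀ g ∈ G, I.vars g 2 ≠ v ∧ I.vars g 3 ≠ v := by
  intro g hg
  refine ⟨fun e => ?_, fun e => ?_⟩
  · have : I.vars g 3 ∈ partners I G v := (mem_partners_iff I hI).2 ⟨g, hg, Or.inl ⟨e, rfl⟩⟩
    rw [h] at this; exact absurd this (notMem_empty _)
  · have : I.vars g 2 ∈ partners I G v := (mem_partners_iff I hI).2 ⟨g, hg, Or.inr ⟨rfl, e⟩⟩
    rw [h] at this; exact absurd this (notMem_empty _)

/-- The empty G-constraint is `false`. -/
theorem gval_empty (x : Fin n → Bool) : gval I ∅ ∅ x = false := by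
  apply bit_injective
  rw [bit_gval, sum_empty, sum_empty, add_zero]
  rfl

/-- A variable read linearly and in no monomial moves the reader at every point. -/
theorem mv_of_lin (hI : I.IsPure xorAndPred) (hS : SimpleOverlap I) {C : Finset (Fin n)} {G : Finset (Fin m)} {v : Fin n} (hC : v ∈ C)
    (hG : ∀ g ∈ G, I.vars g 2 ≠ v ∧ I.vars g 3 ≠ v) (x : Fin n → Bool) : mv I C G v x = true := by
  rw [mv_eq_partners I hI hS, partners_eq_empty I hG, gval_empty, decide_eq_true hC]; rfl

end Partners

section TypeI

variable {I : LocalMap 4 n m} {r : ℕ} {y : Fin m → Bool} {J₀ : Finset (Fin m)} {w₁ w₂ : Finset (Fin n) × Finset (Fin m) × Bool}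
  {cᵢ cⱼ gᵢ gⱼ : Fin m} {vᵢ vᵢ' zᵢ vⱼ vⱼ' zⱼ z : Fin n}

/-- **In type `(1,0)`, uncoupled outside variables do not move `Γ₂` on the slice.**  `gᵢ = (vᵢ, zᵢ) ∈ G₁ ∖ G₂` an outside gate on `cᵢ` (`vᵢ'` the
co-private), `z ≠ zᵢ` outside, uncoupled from `zᵢ`, in no monomial with `vᵢ`; then `mv₂ z x = 0` at every solution with `x_{vᵢ'} = 0`. -/
theorem mv₂_eq_false_of_typeI (hI : I.IsPure xorAndPred) (hS : SimpleOverlap I) (ht : Terminal I r y J₀ w₁ w₂) (hcᵢ : cᵢ ∈ J₀)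
    (hchᵢ : IsChord I J₀ cᵢ) (hvᵢ : (I.vars cᵢ 2 = vᵢ ∧ I.vars cᵢ 3 = vᵢ') ∨ (I.vars cᵢ 2 = vᵢ' ∧ I.vars cᵢ 3 = vᵢ))
    (hgᵢ₁ : gᵢ ∈ w₁.2.1) (hgᵢ₂ : gᵢ ∉ w₂.2.1) (hpᵢ : (I.vars gᵢ 2 = vᵢ ∧ I.vars gᵢ 3 = zᵢ) ∨ (I.vars gᵢ 2 = zᵢ ∧ I.vars gᵢ 3 = vᵢ))
    (hzᵢ : ∀ j ∈ J₀, zᵢ ∉ varSet I j) (hz : ∀ j ∈ J₀, z ∉ varSet I j) (hzz : zᵢ ≠ z)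
    (hnozz : ∀ h ∈ w₁.2.1 ∪ w₂.2.1, ¬ ((I.vars h 2 = z ∧ I.vars h 3 = zᵢ) ∨ (I.vars h 2 = zᵢ ∧ I.vars h 3 = z)))
    (hnoz : ∀ h ∈ w₁.2.1 ∪ w₂.2.1, ¬ ((I.vars h 2 = z ∧ I.vars h 3 = vᵢ) ∨ (I.vars h 2 = vᵢ ∧ I.vars h 3 = z)))
    {x : Fin n → Bool} (hx : ∀ j ∈ J₀, I.eval x j = y j) (h0 : x vᵢ' = false) : mv I w₂.1 w₂.2.1 z x = false := by
  classical
  have hvzᵢ : vᵢ ≠ zᵢ := by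
    rcases hvᵢ with ⟨h2, -⟩ | ⟨-, h3⟩
    · exact fun e => hzᵢ cᵢ hcᵢ (e ▸ h2 ▸ vars_mem_varSet I cᵢ 2)
    · exact fun e => hzᵢ cᵢ hcᵢ (e ▸ h3 ▸ vars_mem_varSet I cᵢ 3)
  set x₁ := Function.update x vᵢ (!x vᵢ) with hx₁
  have hs₁ : ∀ j ∈ J₀, I.eval x₁ j = y j := solves_update_priv hI hcᵢ hchᵢ hvᵢ hx h0 _
  have R₀ := rank_one_out hI ht hzᵢ hz hzz hnozz hx
  have R₁ := rank_one_out hI ht hzᵢ hz hzz hnozz hs₁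
  have Aᵢ : ∀ (C : Finset (Fin n)) (G : Finset (Fin m)), mv I C G zᵢ x₁ = xor (mv I C G zᵢ x) (decide (gᵢ ∈ G)) :=
    fun C G => mv_flip_gate hI hS C G hpᵢ hvzᵢ x
  have B : ∀ (C : Finset (Fin n)) (G : Finset (Fin m)), G ⊆ w₁.2.1 ∪ w₂.2.1 → mv I C G z x₁ = mv I C G z x :=
    fun C G hG => mv_update_of_ne I C G (fun h hh => hnoz h (hG hh)) x _
  rw [Aᵢ, Aᵢ, B _ _ subset_union_left, B _ _ subset_union_right, decide_eq_true hgᵢ₁, decide_eq_false hgᵢ₂] at R₁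
  have key := parallel_of_two_point (mv I w₁.1 w₁.2.1 z x) (mv I w₂.1 w₂.2.1 z x) (mv I w₁.1 w₁.2.1 zᵢ x) (mv I w₂.1 w₂.2.1 zᵢ x)
    true false R₀ R₁
  simpa using key

/-- **In type `(1,0)` the gated private is not read linearly by `Γ₂`.**  Gates `gᵢ = (vᵢ, zᵢ) ∈ G₁ ∖ G₂` on `cᵢ` and `gⱼ = (vⱼ, zⱼ) ∈ G₁` on `cⱼ`,
`zᵢ, zⱼ` distinct and uncoupled, `zⱼ` in no monomial with `vᵢ`, NO monomial of `G₂` on `vᵢ`, and one solution with both co-privates `0`: then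
`vᵢ ∉ C₂`. -/
theorem not_mem_lin₂_of_typeI (hI : I.IsPure xorAndPred) (hS : SimpleOverlap I) (ht : Terminal I r y J₀ w₁ w₂) (hcᵢ : cᵢ ∈ J₀)
    (hcⱼ : cⱼ ∈ J₀) (hne : cᵢ ≠ cⱼ) (hchᵢ : IsChord I J₀ cᵢ) (hchⱼ : IsChord I J₀ cⱼ)
    (hvᵢ : (I.vars cᵢ 2 = vᵢ ∧ I.vars cᵢ 3 = vᵢ') ∨ (I.vars cᵢ 2 = vᵢ' ∧ I.vars cᵢ 3 = vᵢ))
    (hvⱼ : (I.vars cⱼ 2 = vⱼ ∧ I.vars cⱼ 3 = vⱼ') ∨ (I.vars cⱼ 2 = vⱼ' ∧ I.vars cⱼ 3 = vⱼ))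
    (hgᵢ₁ : gᵢ ∈ w₁.2.1) (hgᵢ₂ : gᵢ ∉ w₂.2.1) (hpᵢ : (I.vars gᵢ 2 = vᵢ ∧ I.vars gᵢ 3 = zᵢ) ∨ (I.vars gᵢ 2 = zᵢ ∧ I.vars gᵢ 3 = vᵢ))
    (hzᵢ : ∀ j ∈ J₀, zᵢ ∉ varSet I j)
    (hgⱼ₁ : gⱼ ∈ w₁.2.1) (hpⱼ : (I.vars gⱼ 2 = vⱼ ∧ I.vars gⱼ 3 = zⱼ) ∨ (I.vars gⱼ 2 = zⱼ ∧ I.vars gⱼ 3 = vⱼ))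
    (hzⱼ : ∀ j ∈ J₀, zⱼ ∉ varSet I j) (hzz : zᵢ ≠ zⱼ)
    (hnozz : ∀ h ∈ w₁.2.1 ∪ w₂.2.1, ¬ ((I.vars h 2 = zⱼ ∧ I.vars h 3 = zᵢ) ∨ (I.vars h 2 = zᵢ ∧ I.vars h 3 = zⱼ)))
    (hnoⱼ : ∀ h ∈ w₁.2.1 ∪ w₂.2.1, ¬ ((I.vars h 2 = zⱼ ∧ I.vars h 3 = vᵢ) ∨ (I.vars h 2 = vᵢ ∧ I.vars h 3 = zⱼ)))
    (hG₂vᵢ : ∀ g ∈ w₂.2.1, I.vars g 2 ≠ vᵢ ∧ I.vars g 3 ≠ vᵢ)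
    {x : Fin n → Bool} (hx : ∀ j ∈ J₀, I.eval x j = y j) (h0ᵢ : x vᵢ' = false) (h0ⱼ : x vⱼ' = false) : vᵢ ∉ w₂.1 := by
  classical
  intro hC
  -- distinctness
  have memᵢ : vᵢ ∈ varSet I cᵢ ∧ vᵢ' ∈ varSet I cᵢ ∧ vᵢ ∈ bdry I J₀ := by
    rcases hvᵢ with ⟨h2, h3⟩ | ⟨h2, h3⟩
    · exact ⟨h2 ▸ vars_mem_varSet I cᵢ 2, h3 ▸ vars_mem_varSet I cᵢ 3, h2 ▸ hchᵢ.1⟩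
    · exact ⟨h3 ▸ vars_mem_varSet I cᵢ 3, h2 ▸ vars_mem_varSet I cᵢ 2, h3 ▸ hchᵢ.2⟩
  have memⱼ : vⱼ ∈ varSet I cⱼ ∧ vⱼ' ∈ varSet I cⱼ ∧ vⱼ ∈ bdry I J₀ := by
    rcases hvⱼ with ⟨h2, h3⟩ | ⟨h2, h3⟩
    · exact ⟨h2 ▸ vars_mem_varSet I cⱼ 2, h3 ▸ vars_mem_varSet I cⱼ 3, h2 ▸ hchⱼ.1⟩
    · exact ⟨h3 ▸ vars_mem_varSet I cⱼ 3, h2 ▸ vars_mem_varSet I cⱼ 2, h3 ▸ hchⱼ.2⟩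
  have hvⱼᵢ' : vⱼ ≠ vᵢ' := fun e => not_mem_varSet_of_private I hcⱼ hcᵢ hne memⱼ.2.2 memⱼ.1 (e ▸ memᵢ.2.1)
  have hvzⱼ : vⱼ ≠ zⱼ := fun e => hzⱼ cⱼ hcⱼ (e ▸ memⱼ.1)
  have hzⱼvᵢ : zⱼ ≠ vᵢ := fun e => hzⱼ cᵢ hcᵢ (e ▸ memᵢ.1)
  have hzⱼvᵢ' : zⱼ ≠ vᵢ' := fun e => hzⱼ cᵢ hcᵢ (e ▸ memᵢ.2.1)
  -- `mv₂ zⱼ = 0` at `x` and at `x ⊕ e_{vⱼ}`, and `mv₁ zⱼ` differs at the two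
  set x' := Function.update x vⱼ (!x vⱼ) with hx'
  have hs' : ∀ j ∈ J₀, I.eval x' j = y j := solves_update_priv hI hcⱼ hchⱼ hvⱼ hx h0ⱼ _
  have h0ᵢ' : x' vᵢ' = false := by rw [hx', Function.update_of_ne hvⱼᵢ'.symm]; exact h0ᵢ
  have M := fun (P : Fin n → Bool) (hP : ∀ j ∈ J₀, I.eval P j = y j) (hP0 : P vᵢ' = false) =>
    mv₂_eq_false_of_typeI (z := zⱼ) hI hS ht hcᵢ hchᵢ hvᵢ hgᵢ₁ hgᵢ₂ hpᵢ hzᵢ hzⱼ hzz hnozz hnoⱼ hP hP0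
  have flip₁ : mv I w₁.1 w₁.2.1 zⱼ x' = !mv I w₁.1 w₁.2.1 zⱼ x := by
    rw [hx', mv_flip_gate hI hS _ _ hpⱼ hvzⱼ x, decide_eq_true hgⱼ₁]; cases mv I w₁.1 w₁.2.1 zⱼ x <;> rfl
  -- the point where `zⱼ` moves `Γ₁`
  obtain ⟨P, hP, hP0, hP₁⟩ : ∃ P : Fin n → Bool, (∀ j ∈ J₀, I.eval P j = y j) ∧ P vᵢ' = false ∧ mv I w₁.1 w₁.2.1 zⱼ P = true := by
    by_cases h : mv I w₁.1 w₁.2.1 zⱼ x = true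
    · exact ⟨x, hx, h0ᵢ, h⟩
    · exact ⟨x', hs', h0ᵢ', by rw [flip₁]; simpa using h⟩
  have hP₂ : mv I w₂.1 w₂.2.1 zⱼ P = false := M P hP hP0
  have hV₂ : mv I w₂.1 w₂.2.1 vᵢ P = true := mv_of_lin I hI hS hC hG₂vᵢ P
  -- the flips of `zⱼ` and `vᵢ` are independent at `P`
  have hPz := solves_update_of_outside hzⱼ hP (!P zⱼ)
  have hP0' : Function.update P zⱼ (!P zⱼ) vᵢ' = false := by rw [Function.update_of_ne hzⱼvᵢ'.symm]; exact hP0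
  refine false_of_independent_flips hI ht hzⱼvᵢ (fun g hg H => hnoⱼ g hg H.symm) hP hPz
    (solves_update_priv hI hcᵢ hchᵢ hvᵢ hP hP0 _) (solves_update_priv hI hcᵢ hchᵢ hvᵢ hPz hP0' _) ?_
  rw [hP₁, hP₂, hV₂]
  simp

/-- **In type `(1,0)` the partners of the other chord are invisible to `Γ₂`.**  `gⱼ = (vⱼ, zⱼ) ∈ G₁ ∖ G₂` an outside gate on `cⱼ` (`vⱼ'` the
co-private), `z'` outside, `z' ≠ zⱼ` uncoupled, `z'` in no monomial with a private of `cⱼ`, `cⱼ` slice-generic (any menu), the instance typed, and one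
solution with `x_{vⱼ'} = 0`: then `z' ∉ C₂` and no monomial of `G₂` contains `z'`. -/
theorem invisible₂_of_typeI (hI : I.IsPure xorAndPred) (hT : Typed I) (hS : SimpleOverlap I) (ht : Terminal I r y J₀ w₁ w₂) (hcⱼ : cⱼ ∈ J₀)
    (hchⱼ : IsChord I J₀ cⱼ) (hvⱼ : (I.vars cⱼ 2 = vⱼ ∧ I.vars cⱼ 3 = vⱼ') ∨ (I.vars cⱼ 2 = vⱼ' ∧ I.vars cⱼ 3 = vⱼ))
    (hgⱼ₁ : gⱼ ∈ w₁.2.1) (hgⱼ₂ : gⱼ ∉ w₂.2.1) (hpⱼ : (I.vars gⱼ 2 = vⱼ ∧ I.vars gⱼ 3 = zⱼ) ∨ (I.vars gⱼ 2 = zⱼ ∧ I.vars gⱼ 3 = vⱼ))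
    (hzⱼ : ∀ j ∈ J₀, zⱼ ∉ varSet I j) {z' : Fin n} (hz' : ∀ j ∈ J₀, z' ∉ varSet I j) (hzz : zⱼ ≠ z')
    (hnozz : ∀ h ∈ w₁.2.1 ∪ w₂.2.1, ¬ ((I.vars h 2 = z' ∧ I.vars h 3 = zⱼ) ∨ (I.vars h 2 = zⱼ ∧ I.vars h 3 = z')))
    (hno₂ : ∀ h ∈ w₁.2.1 ∪ w₂.2.1, ¬ ((I.vars h 2 = z' ∧ I.vars h 3 = I.vars cⱼ 2) ∨ (I.vars h 2 = I.vars cⱼ 2 ∧ I.vars h 3 = z')))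
    (hno₃ : ∀ h ∈ w₁.2.1 ∪ w₂.2.1, ¬ ((I.vars h 2 = z' ∧ I.vars h 3 = I.vars cⱼ 3) ∨ (I.vars h 2 = I.vars cⱼ 3 ∧ I.vars h 3 = z')))
    {𝒢 : Finset (Fin m)} (hgenⱼ : SliceGeneric I y J₀ cⱼ 𝒢)
    {x : Fin n → Bool} (hx : ∀ j ∈ J₀, I.eval x j = y j) (h0ⱼ : x vⱼ' = false) :
    z' ∉ w₂.1 ∧ ∀ h ∈ w₂.2.1, I.vars h 2 ≠ z' ∧ I.vars h 3 ≠ z' := by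
  classical
  have hnovⱼ : ∀ h ∈ w₁.2.1 ∪ w₂.2.1, ¬ ((I.vars h 2 = z' ∧ I.vars h 3 = vⱼ) ∨ (I.vars h 2 = vⱼ ∧ I.vars h 3 = z')) := by
    rcases hvⱼ with ⟨h2, -⟩ | ⟨-, h3⟩
    · rw [← h2]; exact hno₂
    · rw [← h3]; exact hno₃
  -- `mv₂ z' = 0` on the slice `vⱼ' = 0`
  have M : ∀ P : Fin n → Bool, (∀ j ∈ J₀, I.eval P j = y j) → P vⱼ' = false → mv I w₂.1 w₂.2.1 z' P = false :=
    fun P hP hP0 => mv₂_eq_false_of_typeI (z := z') hI hS ht hcⱼ hchⱼ hvⱼ hgⱼ₁ hgⱼ₂ hpⱼ hzⱼ hz' hzz hnozz hnovⱼ hP hP0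
  -- as a linear G-constraint it is chord-local at `cⱼ`
  set P₂ := partners I w₂.2.1 z' with hP₂
  have hloc : ChordLocal I cⱼ P₂ ∅ := by
    refine chordLocal_of_fail_slice hI hcⱼ hchⱼ (sliceGeneric_mono (empty_subset 𝒢) hgenⱼ) (fun g hg => absurd hg (notMem_empty g))
      (Subset.refl _) false false (!decide (z' ∈ w₂.1)) fun P hP hP2 hP3 h => ?_
    have hP0 : P vⱼ' = false := by
      rcases hvⱼ with ⟨-, h3⟩ | ⟨h2, -⟩
      · rw [← h3]; exact hP3
      · rw [← h2]; exact hP2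
    have hM := M P hP hP0
    rw [mv_eq_partners I hI hS, ← hP₂, h] at hM
    revert hM; cases decide (z' ∈ w₂.1) <;> decide
  obtain ⟨φ, hφ⟩ := hloc
  -- a chord-local linear form in non-chord variables is empty
  have hempty : P₂ = ∅ := by
    refine eq_empty_of_forall_notMem fun u hu => ?_
    obtain ⟨h, hh, hhu⟩ := (mem_partners_iff I hI).1 (hP₂ ▸ hu)
    -- `u` is none of the four variables of `cⱼ`
    have hslot : ∃ s : Fin 4, 2 ≤ s.val ∧ I.vars h s = u := by
      rcases hhu with ⟨-, h3⟩ | ⟨h2, -⟩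
      exacts [⟨3, by decide, h3⟩, ⟨2, by decide, h2⟩]
    obtain ⟨s, hs, hsu⟩ := hslot
    have hu0 : u ≠ I.vars cⱼ 0 := fun e => hT cⱼ h 0 s (by decide) hs (by rw [hsu, e])
    have hu1 : u ≠ I.vars cⱼ 1 := fun e => hT cⱼ h 1 s (by decide) hs (by rw [hsu, e])
    have hu2 : u ≠ I.vars cⱼ 2 := fun e => hno₂ h (mem_union_right _ hh) (by rw [← e]; exact hhu)
    have hu3 : u ≠ I.vars cⱼ 3 := fun e => hno₃ h (mem_union_right _ hh) (by rw [← e]; exact hhu)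
    -- indicator test
    have e0 := hφ (fun _ => false)
    have e1 := hφ (Function.update (fun _ => false) u true)
    rw [Function.update_of_ne hu0.symm, Function.update_of_ne hu1.symm, Function.update_of_ne hu2.symm, Function.update_of_ne hu3.symm,
      ← e0, gval_false] at e1
    have hflip : Function.update (fun _ : Fin n => false) u true = Function.update (fun _ : Fin n => false) u (!(fun _ : Fin n => false) u) := rfl
    rw [hflip, gval_flip I _ _ hI, gval_false] at e1
    have hmv : mv I P₂ ∅ u (fun _ => false) = true := by
      unfold mv
      rw [coef_eq_partners I hI hS, if_pos hu, partners_eq_empty I (fun g hg => absurd hg (notMem_empty g)), sum_empty, add_zero]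
      decide
    rw [hmv] at e1
    exact absurd e1 (by decide)
  have hG₂ : ∀ h ∈ w₂.2.1, I.vars h 2 ≠ z' ∧ I.vars h 3 ≠ z' := forall_ne_of_partners_eq_empty I hI (hP₂ ▸ hempty)
  refine ⟨fun hC => ?_, hG₂⟩
  have hM := M x hx h0ⱼ
  rw [mv_of_lin I hI hS hC hG₂] at hM
  exact absurd hM (by decide)

/-- **FREE LUNCH WITH TRANSPORT.**  An outside gate `gᵢ = (vᵢ, zᵢ) ∈ G₁` on the chord `cᵢ` with `Γ₂` blind to `vᵢ` and to `zᵢ` and with no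
monomial of `G₂` on the AND pair of `cᵢ`: then `Γ₂` fails on the whole slice `co-private = 0` (at one of `x, x ⊕ e_{vᵢ}` the switch `zᵢ` moves `Γ₁`
alone), so `Γ₂` is chord-local at `cᵢ` if `cᵢ` is slice-generic for the menu of `Γ₂`. -/
theorem chordLocal₂_of_clean (hI : I.IsPure xorAndPred) (hS : SimpleOverlap I) (ht : Terminal I r y J₀ w₁ w₂) (hcᵢ : cᵢ ∈ J₀)
    (hchᵢ : IsChord I J₀ cᵢ) (hvᵢ : (I.vars cᵢ 2 = vᵢ ∧ I.vars cᵢ 3 = vᵢ') ∨ (I.vars cᵢ 2 = vᵢ' ∧ I.vars cᵢ 3 = vᵢ))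
    (hgᵢ₁ : gᵢ ∈ w₁.2.1) (hpᵢ : (I.vars gᵢ 2 = vᵢ ∧ I.vars gᵢ 3 = zᵢ) ∨ (I.vars gᵢ 2 = zᵢ ∧ I.vars gᵢ 3 = vᵢ))
    (hzᵢ : ∀ j ∈ J₀, zᵢ ∉ varSet I j) (hzC : zᵢ ∉ w₂.1) (hzG : ∀ g ∈ w₂.2.1, I.vars g 2 ≠ zᵢ ∧ I.vars g 3 ≠ zᵢ) (hvC : vᵢ ∉ w₂.1)
    (hmono : ∀ g ∈ w₂.2.1, (I.vars g 2 ≠ I.vars cᵢ 2 ∧ I.vars g 3 ≠ I.vars cᵢ 2) ∧ (I.vars g 2 ≠ I.vars cᵢ 3 ∧ I.vars g 3 ≠ I.vars cᵢ 3))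
    {𝒢 : Finset (Fin m)} (h𝒢 : w₂.2.1 ⊆ 𝒢) (hgenᵢ : SliceGeneric I y J₀ cᵢ 𝒢) : ChordLocal I cᵢ w₂.1 w₂.2.1 := by
  classical
  have hvzᵢ : vᵢ ≠ zᵢ := by
    rcases hvᵢ with ⟨h2, -⟩ | ⟨-, h3⟩
    · exact fun e => hzᵢ cᵢ hcᵢ (e ▸ h2 ▸ vars_mem_varSet I cᵢ 2)
    · exact fun e => hzᵢ cᵢ hcᵢ (e ▸ h3 ▸ vars_mem_varSet I cᵢ 3)
  have hvG : ∀ g ∈ w₂.2.1, I.vars g 2 ≠ vᵢ ∧ I.vars g 3 ≠ vᵢ := by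
    intro g hg
    rcases hvᵢ with ⟨h2, -⟩ | ⟨-, h3⟩
    · rw [← h2]; exact (hmono g hg).1
    · rw [← h3]; exact (hmono g hg).2
  refine chordLocal_of_fail_slice hI hcᵢ hchᵢ (sliceGeneric_mono h𝒢 hgenᵢ) hmono (Subset.refl _) false false w₂.2.2 fun x hx hx2 hx3 => ?_
  have h0 : x vᵢ' = false := by
    rcases hvᵢ with ⟨-, h3⟩ | ⟨h2, -⟩
    · rw [← h3]; exact hx3
    · rw [← h2]; exact hx2
  set x₁ := Function.update x vᵢ (!x vᵢ) with hx₁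
  have hs₁ : ∀ j ∈ J₀, I.eval x₁ j = y j := solves_update_priv hI hcᵢ hchᵢ hvᵢ hx h0 _
  have flip₁ : mv I w₁.1 w₁.2.1 zᵢ x₁ = !mv I w₁.1 w₁.2.1 zᵢ x := by
    rw [hx₁, mv_flip_gate hI hS _ _ hpᵢ hvzᵢ x, decide_eq_true hgᵢ₁]; cases mv I w₁.1 w₁.2.1 zᵢ x <;> rfl
  have same₂ : gval I w₂.1 w₂.2.1 x₁ = gval I w₂.1 w₂.2.1 x := gval_update_of_forall_ne I x hvC hvG _
  -- free lunch at the point where `zᵢ` moves `Γ₁`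
  have lunch : ∀ P : Fin n → Bool, (∀ j ∈ J₀, I.eval P j = y j) → mv I w₁.1 w₁.2.1 zᵢ P = true → gval I w₂.1 w₂.2.1 P ≠ w₂.2.2 := by
    intro P hP hmv
    refine gval₂_ne_of_switch₁ ht hzᵢ hzC hzG hP ?_
    rw [gval_flip I _ _ hI, hmv]
    cases gval I w₁.1 w₁.2.1 P <;> decide
  by_cases h : mv I w₁.1 w₁.2.1 zᵢ x = true
  · exact lunch x hx h
  · rw [← same₂]
    exact lunch x₁ hs₁ (by rw [flip₁]; simpa using h)

end TypeI

end Summit.PneNP.PneNP.Theorems.PstarChordReadOutsideClean
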